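import Summits.ResolutionOfSingularities.ResolutionOfSingularities.Theses.UniformComplexity
import Summits.ResolutionOfSingularities.ResolutionOfSingularities.Theorems.UniformComplexityPrimeModelTransferSpecializationLemmas
import Literature.AlgebraicGeometry.Resolution.ChowLemmaRing
import Literature.AlgebraicGeometry.Resolution.QuasiProjectiveResolution
import HarnessLib

/-!
# Crux `PrimeModelTransfer` (stmt-ResolutionOfSingularities-8933), door 2 of slot W8.2:
# the crux is a statement about PROJECTIVE varieties (Nagata + Chow)

Route `ResolutionOfSingularities/UniformComplexity`. The route thesis reads `PrimeModelTransfer`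
through uniformity of resolution complexity in bounded-degree PROJECTIVE families
(Theses/UniformComplexity.lean, header ¶2; `DOOR2-KERNEL.md` §3(b): moduli of bounded blow-ups of
projective varieties). This file records, by name, that both the hypothesis and the conclusion of
the crux may be restricted to PROJECTIVE integral schemes:

* `hasResolution_of_forall_isProjOver` — over any field `K`, if every integral `K`-scheme
  PROJECTIVE over `K` (`ChowLemmaRing.IsProjOver`) has a resolution, so does every integral
  separated `K`-scheme of finite type: compactify (Nagata, `hasResolution_of_forall_proper`,
  p483756), dominate the compactification by a projective integral scheme through a proper
  birational morphism (Chow's lemma, tree `ChowLemmaRing.chow_proper`), and push the resolution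
  down (`Scheme.HasResolution.of_isBirational`);
* `primeModelTransfer_iff_projective` — `UniformComplexity.PrimeModelTransfer` holds iff for every
  prime `p`: resolution of all PROJECTIVE integral schemes over the algebraically closed fields
  algebraic over `𝔽_p` implies resolution of all PROJECTIVE integral schemes over every
  algebraically closed field of characteristic `p`.

[OURS · LADDER-RESOLUTION L1, slot W8.2 (prime-field / universality transfer), door 2
UniformComplexity] Theorems over the summit's own route; NOT statements of, and attributing
nothing to, Hironaka's 2017 manuscript. AI-written; weaker than expert review. No base change of
resolutions occurs here at all.

Sources: B. Conrad, *Deligne's notes on Nagata compactifications* (2007), Thm. 4.1; The Stacks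
Project, Tag 02O2 (Chow's lemma); U. Görtz, T. Wedhorn, *Algebraic Geometry I* (2020), Thm. 13.100.
[cite: Conrad2007, Thm. 4.1] [cite: GortzWedhorn2020, Thm. 13.100]
-/

noncomputable section

set_option linter.dupNamespace false -- mandated namespace of this single-conjunct summit

open CategoryTheory CategoryTheory.Limits AlgebraicGeometry TopologicalSpace
open Literature.AlgebraicGeometry.Resolution
open Summit.ResolutionOfSingularities.ResolutionOfSingularities.Theses.UniformComplexity (PrimeModelTransfer)

namespace Summit.ResolutionOfSingularities.ResolutionOfSingularities.Theorems.PrimeModelTransfer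

/-- **It suffices to resolve PROJECTIVE integral schemes** (Nagata + Chow): over a field `K`, if
every integral `K`-scheme admitting a closed `K`-immersion into some `ℙⁿ_K` has a resolution of
singularities, then every integral separated `K`-scheme of finite type has one. For proper `X`,
Chow's lemma (`ChowLemmaRing.chow_proper`) gives a proper birational `π : X' → X` with `X'`
integral and projective over `K`; a resolution of `X'` composed with `π` resolves `X`
(`Scheme.HasResolution.of_isBirational`); the general case is Nagata's reduction
`hasResolution_of_forall_proper`. [cite: GortzWedhorn2020, Thm. 13.100] -/
theorem hasResolution_of_forall_isProjOver (K : Type) [Field K]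
    (h : ∀ (X : Scheme.{0}) (f : X ⟶ Spec (.of K)),
      ChowLemmaRing.IsProjOver (Over.mk f : Literature.AlgebraicGeometry.Motives.SchemeOver K) →
        IsIntegral X → Scheme.HasResolution X)
    (X : Scheme.{0}) (f : X ⟶ Spec (.of K)) [IsSeparated f] [LocallyOfFiniteType f]
    [QuasiCompact f] [IsIntegral X] : Scheme.HasResolution X := by
  refine hasResolution_of_forall_proper K (fun Y g hg hY => ?_) X f
  haveI := hg
  haveI := hY
  obtain ⟨n, Y', π, ι, hY', hι, hπ, -, hw, U, hUd, hUpre, hUiso⟩ :=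
    ChowLemmaRing.chow_proper (R := K) Y g
  haveI := hπ
  haveI := hι
  have hproj : ChowLemmaRing.IsProjOver
      (Over.mk (π ≫ g) : Literature.AlgebraicGeometry.Motives.SchemeOver K) :=
    ⟨n, Over.homMk ι hw, hι⟩
  exact Scheme.HasResolution.of_isBirational π ⟨U, hUd, hUpre, hUiso⟩ (h Y' (π ≫ g) hproj hY')

/-- **Normal form 4: `PrimeModelTransfer` is a statement about PROJECTIVE varieties.**
`UniformComplexity.PrimeModelTransfer` holds iff for every prime `p`, resolution of all
projective integral schemes over the algebraically closed fields of characteristic `p` algebraic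
over `𝔽_p` implies resolution of all projective integral schemes over every algebraically closed
field of characteristic `p` (both directions through `hasResolution_of_forall_isProjOver`).
[folklore] -/
theorem primeModelTransfer_iff_projective :
    PrimeModelTransfer ↔ ∀ p : ℕ, p.Prime →
      (∀ (k : Type) [Field k] [CharP k p] [IsAlgClosed k],
        (∀ x : k, ∃ n : ℕ, 0 < n ∧ x ^ p ^ n = x) →
        ∀ (X : Scheme.{0}) (f : X ⟶ Spec (.of k)),
          ChowLemmaRing.IsProjOver (Over.mk f : Literature.AlgebraicGeometry.Motives.SchemeOver k) →
            IsIntegral X → Scheme.HasResolution X) →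
      ∀ (K : Type) [Field K] [CharP K p] [IsAlgClosed K] (X : Scheme.{0}) (f : X ⟶ Spec (.of K)),
        ChowLemmaRing.IsProjOver (Over.mk f : Literature.AlgebraicGeometry.Motives.SchemeOver K) →
          IsIntegral X → Scheme.HasResolution X := by
  constructor
  · intro h p hp hAproj K _ _ _ X f hf hX
    haveI := hX
    haveI : IsProper f := hf.isProper
    exact h p hp (fun k _ _ _ hk Y g hs hl hq hY => by
        haveI := hs; haveI := hl; haveI := hq; haveI := hY
        exact hasResolution_of_forall_isProjOver k (fun Z e he hZ => hAproj k hk Z e he hZ) Y g)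
      K X f inferInstance inferInstance inferInstance hX
  · intro h p hp hA K _ _ _ X f hs hl hq hX
    haveI := hs; haveI := hl; haveI := hq; haveI := hX
    exact hasResolution_of_forall_isProjOver K
      (fun Z e he hZ => h p hp (fun k _ _ _ hk Y g _ hY => by
        haveI := hY
        haveI : IsProper g := ‹ChowLemmaRing.IsProjOver _›.isProper
        exact hA k hk Y g inferInstance inferInstance inferInstance hY) K Z e he hZ) X f

end Summit.ResolutionOfSingularities.ResolutionOfSingularities.Theorems.PrimeModelTransfer

end
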